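import Summits.QuantumFields.YangMills.Theorems.UV3BranchExpansionHTopT3AllL
import Summits.QuantumFields.YangMills.Theorems.UV3PinnedMassEnvelopeV3OfN08
import HarnessLib

/-!
# R3 (cell `ym3-torus`, YM₃ on T³ — a ladder RUNG, NOT d = 4, NOT infinite volume, NOT a mass gap, NOT the Clay problem) —
# **(F-TOP-CONSUMERS≤20) THE THREE hTop CONSUMERS WITH hTop DISCHARGED, FOR EVERY THREE-TORUS FAMILY WITH BLOCK SIZE `L ≤ 20`**

Width seat `ym-ust-19936-w8` g12 on crux `stmt-QuantumFields-19936` `UnitScaleTilt.HistoryTailL` (`--supports`, helper; THEOREMS ONLY, 0 `def`, 0 `sorry`).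
★★OWNER RECORD 17br («hTop IS A THEOREM AT L = 3 … which displayed hypotheses of which door are now theorems») made TREE THEOREMS for every `L ≤ 20`: px13 g14's
✓`UV3BranchExpansionHTopT3AllL.topHaarPushforward_of_T3_le_twenty` (hTop(F) for every `F.L ≤ 20`: px8 g13's knit ✓`UV3BranchExpansionHTopSegment` ∘ w8's ✓`hw_su2_of_pow_le_nine` ∕
✓`UV3BranchExpansionHTopSegmentSU2Ranges` ∘ px13's numerals ∘ w2 g17's (C′) ∘ w5 g19's ✓`UV3BranchExpansionHTopT3L3`) fed BY NAME, with no restatement of hTop, into: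
px8 g13's ✓`UV3StartClosedOfTopHaarPushforward.startClosed_avT3_of_topHaarPushforward` (the N08 seat's start-closed family) and ✓`massRecP_avT3_le_exp_ae_of_topHaarPushforward`
(dag-n08-d's flat a.e. mass envelope `hN08`), the S-organ letter ✓`AlphaInputsT3AC.Of.linMassEnvelope_all_of_topHaarPushforward` (LEAD g11∕g12's
✓`UV3PinnedStepOrganOfTopPartialIterates`, row (S-ii)), and ✓`AlphaInputsT3AC.OfV3At.hJ_of_topHaarPushforward` (✓`UV3PinnedMassEnvelopeV3OfN08`, hJ(v3)).
RECORD CURRENCY (★★OWNER WORDS 84 (2) ∕ 85 (4) ∕ ACK 145): hTop and these consumers are SUPPLY for NODE O B3 ∕ Track A's N08, NOT rows of the 19936 registry v6 {EX, (O‴χₛ)}.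

HYP-SAT (★★OWNER RULING №42, literal T³ families `avT3 = blockAvg ℰp`, `d = 3`): the ONLY door hypothesis left is `h20 : F.L ≤ 20` (block sizes `L ∈ {3, 5, …, 19}` — `3 ≤ L` is
automatic from `T3Family.hL = «Odd L ∧ 1 < L»`, px13's v1.0.1 corollary); for `L ≥ 21` the tree has (H_K) only existentially (n08 part 30C's `1∕400` injectivity margin) — NOT covered, said so.
§2–§3 keep the SOCKETS `h : AlphaInputsT3AC.Of F 𝔠` ∕ `h : OfV3At F 𝔠 a₀ a₁` displayed: they are the registered CONTENT ((α) ∕ v3 package), not doors (RULING №38).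

CONTENTS.  §1 ★★★ `startClosed_avT3_of_le_twenty`, ★★★ `massRecP_avT3_le_exp_ae_of_le_twenty` (HYPOTHESIS-FREE but `L ≤ 20`) · §2 ★★★ `linMassEnvelope_all_of_le_twenty`
((S-ii) from the (α) socket alone) · §3 ★★ `hJ_of_le_twenty` (hJ(v3) from the v3 socket alone) — all over px13 g14's one-hypothesis door ✓`topHaarPushforward_of_T3_le_twenty`.

HONEST SCOPE.  One- to three-line corollaries BY NAME ([folklore] bookkeeping); the conclusions are copied byte-for-byte from the consumers; nothing of the χ record ∕ (O‴χₛ) ∕ EX ∕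
`HistoryTailL` (19936) ∕ `YM3TorusSU2` ∕ the rung ∕ d = 4 ∕ a mass gap ∕ Clay is proved.  YM₃ on T³ is rung R3 of the ladder, not the Clay problem.

References: T. Bałaban, CMP **102** (1985) 255–275 [Balaban1985UV3] ((2) p. 256, (5) p. 257, (41) p. 266); T. Bałaban, CMP **109** (1987) 249–301 [Balaban1987RG1]
((0.4), (0.11) p. 253).
-/

set_option autoImplicit false

noncomputable section

namespace Summit.QuantumFields.YangMills.Theorems.UV3HTopConsumersLeTwenty

open MeasureTheory
open scoped ENNReal
open Literature.MathematicalPhysics.QuantumFieldTheory.Balaban1983to89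
open Literature.MathematicalPhysics.QuantumFieldTheory.Balaban1983to89.T3ContinuumYM3Torus
open Literature.MathematicalPhysics.QuantumFieldTheory.Balaban1983to89.T4AvgSensitivity (iterFrom)
open Literature.MathematicalPhysics.QuantumFieldTheory.Balaban1985CMP102
open Literature.MathematicalPhysics.QuantumFieldTheory.Balaban1985CMP102.Setting
open Summit.QuantumFields.Balaban3D.Carriers
open Summit.QuantumFields.Balaban3D.Proofs.Primitives
open Summit.QuantumFields.Balaban3D.Proofs.GroupModelLieC
open Summit.QuantumFields.Balaban3D.Proofs.StandardAC
open Summit.QuantumFields.Balaban3D.Proofs.InputsAC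
open Summit.QuantumFields.Balaban3D.Proofs.MassesAC
open Summit.QuantumFields.Balaban3D.Proofs.MassesPAC
open Summit.QuantumFields.Balaban3D.Proofs.TowerAC
open Summit.QuantumFields.YangMills.Theorems.UV3BranchExpansionHTopT3AllL (topHaarPushforward_of_T3_le_twenty)
open Summit.QuantumFields.YangMills.Theorems.UV3StartClosedOfTopHaarPushforward (startClosed_avT3_of_topHaarPushforward
  massRecP_avT3_le_exp_ae_of_topHaarPushforward)

/-! ## §1 The N08 seat's two consumers, HYPOTHESIS-FREE on `L ≤ 20` (hTop := px13's one-hypothesis door `topHaarPushforward_of_T3_le_twenty`) -/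

/-- ★★★ **THE CANONICAL PER-START FAMILY OF `avT3` IS (start)∕(step)-CLOSED AND CAPPED BY `e^{A₁}·dU_K` AT THE TOP, for every T³ family with `L ≤ 20`** —
px8 g13's ✓`startClosed_avT3_of_topHaarPushforward` with hTop DISCHARGED (the `hN08`-type letter of dag-n08-d's ✓`massRecP_avT3_le_exp_ae_of_startClosed`, no hypothesis but the
block-size range). [cite: Balaban1985UV3, (2) p.256 + (5) p.257 (bookkeeping); Balaban1985Averaging, (15) p.19; Balaban1987RG1, (0.11) p.253] -/
theorem startClosed_avT3_of_le_twenty (F : T3Family) (h20 : F.L ≤ 20) :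
    ∃ A₁ : ℝ, 0 ≤ A₁ ∧ ∀ K : ℕ, ∃ μ : ℕ → ∀ k, Measure (GaugeField (F.P K) k (Matrix.specialUnitaryGroup (Fin 2) ℂ)),
      (∀ j, j < K → (fieldMeasure (F.P K) j _).map (avT3 F K j).avg ≤ μ j (j + 1)) ∧
      (∀ j k, j < k → k < K → (μ j k).map (avT3 F K k).avg ≤ μ j (k + 1)) ∧
      (∀ j, j < K → μ j K ≤ ENNReal.ofReal (Real.exp A₁) • fieldMeasure (F.P K) K _) :=
  startClosed_avT3_of_topHaarPushforward F (topHaarPushforward_of_T3_le_twenty F h20)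

/-- ★★★ **THE FLAT a.e. ENVELOPE OF THE PINNED MASSES OF `avT3` — EVERY RUN, EVERY HISTORY, ALL CARRIER PARAMETERS — for every T³ family with `L ≤ 20`, NO HYPOTHESIS**
but the range: `∃ A₁ ≥ 0, ∀ K M₁ Rcol εL εS r, massRecP M₁ Rcol εL εS (avT3 F K) K r W ≤ e^{A₁}` for `dU_K`-a.e. `W` (px8's ✓`massRecP_avT3_le_exp_ae_of_topHaarPushforward` ∘ px13's door).
[cite: Balaban1985UV3, (41) p.266 + (48) p.268 + (2) p.256 (the masses; bookkeeping); Balaban1985Averaging, (15) p.19; Balaban1987RG1, (0.11) p.253] -/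
theorem massRecP_avT3_le_exp_ae_of_le_twenty (F : T3Family) (h20 : F.L ≤ 20) :
    ∃ A₁ : ℝ, 0 ≤ A₁ ∧ ∀ (K : ℕ) (M₁ : ℕ) (Rcol : ℕ → ℕ) (εL εS : ℕ → ℝ) (r : Hist (F.P K) K),
      ∀ᵐ W ∂(fieldMeasure (F.P K) K (Matrix.specialUnitaryGroup (Fin 2) ℂ)), massRecP M₁ Rcol εL εS (avT3 F K) K r W ≤ Real.exp A₁ :=
  massRecP_avT3_le_exp_ae_of_topHaarPushforward F (topHaarPushforward_of_T3_le_twenty F h20)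

/-! ## §2 The S-organ row (S-ii) from the (α) socket alone, `L ≤ 20` -/

variable {F : T3Family} {𝔠 : AlphaConsts F.L (suGroupModel 2).N}

/-- ★★★ **THE LINEAR MASS ENVELOPE FOR EVERY HISTORY FROM THE (α) SOCKET AND THE γ-WINDOW ALONE, for every T³ family with `L ≤ 20`** — the organ's
✓`AlphaInputsT3AC.Of.linMassEnvelope_all_of_topHaarPushforward` (row (S-ii)) with hTop DISCHARGED by px13's door: `m_K(r,·) ≤ (K+1)·e^{A₁}` `dV_K`-a.e. for every run `K` and history `r`.
[cite: Balaban1985UV3, (41) p.266 + (2) p.256 + (5) p.257; Balaban1985Averaging, (15) p.19; Balaban1987RG1, (0.11) p.253] -/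
theorem linMassEnvelope_all_of_le_twenty (h : AlphaInputsT3AC.Of F 𝔠) (γ : ℝ) (hγ : 0 < γ) (hγ1 : γ ≤ (min 𝔠.gamma0 1) ^ 2) (h20 : F.L ≤ 20) :
    ∃ A₁ : ℝ, 0 ≤ A₁ ∧ ∀ (K : ℕ) (r : Hist (F.P K) K),
      ∀ᵐ W ∂(fieldMeasure (F.P K) K (Matrix.specialUnitaryGroup (Fin 2) ℂ)),
        (inputOfAC 𝔠.lane (h.pkgAt γ hγ hγ1 K).X (h.pkgAt γ hγ hγ1 K).𝔖).W.mass K r W ≤ ((K : ℝ) + 1) * Real.exp A₁ :=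
  h.linMassEnvelope_all_of_topHaarPushforward γ hγ hγ1 (topHaarPushforward_of_T3_le_twenty F h20)

/-! ## §3 hJ(v3) from the v3 socket alone, `L ≤ 20` -/

/-- ★★ **hJ(v3) AT ITS EXACT DISPLAY LETTER FROM THE v3 SOCKET ALONE, for every T³ family with `L ≤ 20`** — ✓`AlphaInputsT3AC.OfV3At.hJ_of_topHaarPushforward` (★★OWNER WORD 68's
letter, FLAT) with hTop DISCHARGED by px13's door. [cite: Balaban1985UV3, (41) p.266 + (5) p.256 (the masses; bookkeeping)] -/
theorem hJ_of_le_twenty {a₀ a₁ : ℝ} (h : AlphaInputsT3AC.OfV3At F 𝔠 a₀ a₁) (hc : 0 < a₀ ∧ 0 < a₁ ∧ 𝔠.B₃ * a₁ ≤ a₀)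
    (γ : ℝ) (hγ : 0 < γ) (hγ1 : γ ≤ (min 𝔠.gamma0 1) ^ 2) (h20 : F.L ≤ 20) :
    ∃ A₁ : ℝ, ∀ (K : ℕ) (r : Hist (F.P K) K),
      Hist.Admissible 𝔠.lane.carrier.M₁ (rcolOf (T3Scales F γ hγ (hγ1.trans (sq_min_one_le _ 𝔠.gamma0_pos)) K) 𝔠.lane.carrier) K r →
      r ≠ Hist.triv (F.P K) K →
      ∀ᵐ W ∂(fieldMeasure (F.P K) K (Matrix.specialUnitaryGroup (Fin 2) ℂ)),
        PinnedStep.massP 𝔠.lane (h.pkgAtV3 hc γ hγ hγ1 K).X K r W ≤ Real.exp A₁ :=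
  AlphaInputsT3AC.OfV3At.hJ_of_topHaarPushforward F 𝔠 γ hγ hγ1 h hc (topHaarPushforward_of_T3_le_twenty F h20)

end Summit.QuantumFields.YangMills.Theorems.UV3HTopConsumersLeTwenty

end
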